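import Literature.MathematicalPhysics.QuantumFieldTheory.Balaban1983to89.Node00.Record13LiveSelector

/-!
# NODE 00 (YM-PLAN Track A) — STAGE 13: THE OPEN-LETTER FAMILY OF WITNESSES `θ₁₃(ε₀, ε₂₉) = theta13LiveOfFamily₂ F N ε₀ ε₂₉ ζ Rz Zt` — BOTH small-field
# letters `ε₀` ([I] (1.2)) AND `ε₂₉` ([I] (2.9)) AS ARGUMENTS — with every Stage-13 face, so that the (D4) ∕ N26 ∕ N1-small consumers instantiate AT THE FAMILY
# with their inequalities (`hsmall : ε₂₉ ≤ …`, `hC4 : δ + 4·ε₂₉ ≤ ε₀`) DISPLAYED, never at a numeral; the witness of record is the member `(1, ⅛)` by `rfl`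

Cell `pub-ymgap`, seat `pub-ymgap-node00-def-K0a` (g3), FILE 9.  dag-lead WORDS-125 (4) ∕ WORDS-129 (4); dag-ref-D g25 ⚑ EPS-PIN (a `Stage13Params` witness pinning
`ε₂₉` at a numeral makes the (D4) «small» row `ε₂₉ ≤ e^{−(5κ+1)}∕(C₃·576·K₀(64,8))` VACUOUS at κ = 2·10⁴).  [I] = [Balaban1987RG1], [III] = [Balaban1988Convergent],
[IV] = [Balaban1989LargeFieldI].

WHAT THIS FILE PROVIDES (definitions of a parameter family + `rfl` ∕ by-name faces; FILE 8's one-letter family and witness of record are MEMBERS by `rfl`).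
* §1 `theta13OfFamily₂ F N ε₀ ε₂₉ ζ Rz Zt : Stage13Params F N := { theta12OfFamilyL F N ε₀ ζ Rz Zt with ε₂₉ := ε₂₉ }` (identity selector; block size `F.L`, κ = 2·10⁴),
  `rfl` views, `admissible_theta13OfFamily₂ (hε : 0 < ε₀) (hε' : 0 < ε₂₉)`, `hasResidualsOfRecord_theta13OfFamily₂`, `theta13OfFamily_eq_family₂` (`rfl`).
* §2 `theta13LiveOfFamily₂ := (theta13OfFamily₂ …).liveRepin₁₃`, `rfl` views, ★ `eight_le_L_theta13LiveOfFamily₂`, `admissible_theta13LiveOfFamily₂ (hε) (hε')`, the κ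
  numerals, `hasResidualsOfRecord_∕ztUnity_theta13LiveOfFamily₂`, ★ `slotsNondegenerate₁₃_theta13LiveOfFamily₂ (h)`, `provisos₁₃_theta13LiveOfFamily₂_of_bg (hbg)`,
  ★★ `exists_k0_of_theta13LiveOfFamily₂_of_provisos₁₃ (hε hε' h)`, ★★★ `exists_k0_of_bg_theta13LiveOfFamily₂ (hε hε' hbg)` (K0″(F) ⟸ P11 at ANY member), and the
  membership faces `theta13LiveOfFamily_eq_family₂`, `theta13LiveOfRecord_eq_family₂` (`rfl`: the witness of record is the member `(eps0OfRecord₁₃, eps29OfFamily 1)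
  = (1, ⅛)`).

* §3 THE ALL-NUMERICS FAMILY `theta13OfNumerics`∕`theta13LiveOfNumerics F N (n : Stage12Numerics) ε₂₉ ζ Rz Zt` (every numeric letter an argument; the dictionary
  the family's): `admissible_… (hn : n.Pos) (hε')`, `eight_le_L_…`, `hasResidualsOfRecord_∕ztUnity_…`, `slotsNondegenerate₁₃_… (h)`, `provisos₁₃_…_of_bg (hbg)`,
  ★★★ `exists_k0_of_bg_theta13LiveOfNumerics (F) (hn) (hε') (hbg)` — THE SOCKET for numerics keyed to print's undetermined constants (def-P11
  LOCATED-P11-NUMERICS: row P11 from [15] Thm 1 needs `C₀ ≥ B₃·cR·A₀∕(1−β)`, `q₀ ≥ p₀`, `εreg`, `γ` tied to [15]'s `B₃, a₀, a₁`; K1′'s `Nmem`∕`γ`): a later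
  `n(B₃, a₀, a₁, …)` instantiates with NO further K0a definition; `theta13LiveOfFamily₂_eq_numerics` (`rfl`) makes §1–§2 and the witness of record members.

* §4 (v1.1, g5) ROW P12 IS PROVISO-FREE AT EVERY ₁₃ LIVE RE-PIN CARRYING K0b's RESIDUALS: ★ `Stage13Params.slotsNondegenerate₁₃_liveRepin_of_localBg (hU) (hres)`
  (the step provisos and the Int-form R-step provisos FILE 8's Int instance reads are `Record13` §4c's THEOREMS of (H-U) ∧ the ζ-laws — no `Provisos₁₃` field is read),
  ★★ `…_of_hasResiduals (hres)` ((H-U) := K0c's `localBgMeasurable`), and HYPOTHESIS-FREE at the families: `slotsNondegenerate₁₃_theta13LiveOfNumerics_of_hasResiduals`,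
  `…_theta13LiveOfFamily₂_of_hasResiduals`, `…_theta13LiveOfRecord_of_hasResiduals` — the `SlotsNondegenerate₁₃` conjunct of the K0 body needs no proviso at any live witness.

HONEST FRAMING.  Bookkeeping; `n.Pos`, `0 < ε₀`, `0 < ε₂₉`, `Provisos₁₃` ∕ `bg` are DISPLAYED hypotheses; no numeral is asserted to be Bałaban's; nothing of Bałaban asserted;
NOT a discharge; counts unmoved (typed 28∕28 · discharged 5∕28); one finite 𝕋⁴ programme at fixed ε — NOT continuum ∕ OS ∕ mass gap ∕ Clay.
No `sorry`, no `axiom`, no `instance`, no `notation`.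
-/

noncomputable section

open MeasureTheory
open scoped BigOperators Matrix.Norms.L2Operator

namespace Literature.MathematicalPhysics.QuantumFieldTheory.Balaban1983to89.Node00

open T4Continuum B14.Eq218Concrete B15RopTotal FlowStep FlowStepRuns

/-! ## §1. The two-letter family at the identity selector -/

section Family2

variable (F : T4Family) (N : ℕ) [NeZero N] (ε₀ ε₂₉ : ℝ)
variable (ζ : ZetaOfRecord F N (numerics7OfFamily ε₀) 1) (Rz : (K : ℕ) → Sect2.Residual (F.P K) (MatA N)) (Zt : (K : ℕ) → TkResidualW F N (FluctV N) K)

/-- **THE STAGE-13 PARAMETER FAMILY WITH BOTH SMALL-FIELD LETTERS OPEN** `θ₀ᶠᵃᵐ,¹³(ε₀, ε₂₉)`: `theta12OfFamilyL F N ε₀ ζ Rz Zt` (block size `F.L`, κ := 2·10⁴) extended by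
the (2.9) fluctuation threshold `ε₂₉` AS AN ARGUMENT. [cite: Balaban1987RG1, (1.2) p.260, (2.9) p.266; Balaban1988Convergent, (2.10) p.256 (bookkeeping witness)] -/
def theta13OfFamily₂ : Stage13Params F N :=
  { theta12OfFamilyL F N ε₀ ζ Rz Zt with ε₂₉ := ε₂₉ }

/-- The family's Stage-12 part IS `θ₀ᶠᵃᵐ·ᴸ(ε₀)` (`rfl`). [cite: Balaban1988Convergent, (2.10) p.256 (bookkeeping)] -/
theorem theta13OfFamily₂_toStage12Params : (theta13OfFamily₂ F N ε₀ ε₂₉ ζ Rz Zt).toStage12Params = theta12OfFamilyL F N ε₀ ζ Rz Zt := rfl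

/-- The family's (2.9) letter IS the argument (`rfl`). [cite: Balaban1987RG1, (2.9) p.266 (bookkeeping)] -/
theorem theta13OfFamily₂_ε₂₉ : (theta13OfFamily₂ F N ε₀ ε₂₉ ζ Rz Zt).ε₂₉ = ε₂₉ := rfl

/-- The family's (1.2) letter IS the argument (`rfl`). [cite: Balaban1987RG1, (1.2) p.260 (bookkeeping)] -/
theorem theta13OfFamily₂_ε₀ : (theta13OfFamily₂ F N ε₀ ε₂₉ ζ Rz Zt).ν.ε₀ = ε₀ := rfl

/-- The family's rate `κ = 2·10⁴` (`rfl`). [cite: Balaban1987RG1, (1.18) p.263 (bookkeeping)] -/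
theorem theta13OfFamily₂_κ : (theta13OfFamily₂ F N ε₀ ε₂₉ ζ Rz Zt).s2.lf.κ = 20000 := rfl

/-- The family's block size IS the family's: `ℓ₆ + 1 = F.L`. [cite: Balaban1987RG1, (0.1) p.251 (bookkeeping)] -/
theorem theta13OfFamily₂_ℓ₆_succ : (theta13OfFamily₂ F N ε₀ ε₂₉ ζ Rz Zt).ℓ₆ + 1 = F.L := stage3OfFamily_ℓ₆_succ F

variable {ε₀ ε₂₉} in
/-- **The family is Stage-13 admissible under the two displayed signs `0 < ε₀`, `0 < ε₂₉`.** [cite: Balaban1987RG1, (0.21) p.256, (1.2) p.260, (2.9) p.266; Balaban1988Convergent, (2.10) p.256 (bookkeeping witness)] -/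
theorem admissible_theta13OfFamily₂ (hε : 0 < ε₀) (hε' : 0 < ε₂₉) : (theta13OfFamily₂ F N ε₀ ε₂₉ ζ Rz Zt).Admissible F N :=
  ⟨admissible_theta12OfFamilyL F N ζ Rz Zt hε, hε'⟩

/-- The family carries K0b's residuals of record (`⟨rfl, rfl, rfl⟩`). [cite: Balaban1988Convergent, (3.16) p.268, (2.21) p.258, (3.20) p.269 (bookkeeping)] -/
theorem hasResidualsOfRecord_theta13OfFamily₂ :
    (theta13OfFamily₂ F N ε₀ ε₂₉ (zeta316OfRecord F N (numerics7OfFamily ε₀) 1 1) (RzOfRecord F N) (ZtOfRecord F N)).HasResidualsOfRecord F N :=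
  ⟨rfl, rfl, rfl⟩

/-- **FILE 8's one-letter family IS the member `ε₂₉ := ε₀ ∕ 8`** (`rfl`). [cite: Balaban1987RG1, (2.9) p.266 (bookkeeping)] -/
theorem theta13OfFamily_eq_family₂ : theta13OfFamily F N ε₀ ζ Rz Zt = theta13OfFamily₂ F N ε₀ (eps29OfFamily ε₀) ζ Rz Zt := rfl

end Family2

/-! ## §2. The two-letter family at the ₁₃ live selector, its faces, and the membership of the witness of record -/

section LiveFamily2

variable (F : T4Family) (N : ℕ) [NeZero N] (ε₀ ε₂₉ : ℝ)
variable (ζ : ZetaOfRecord F N (numerics7OfFamily ε₀) 1) (Rz : (K : ℕ) → Sect2.Residual (F.P K) (MatA N)) (Zt : (K : ℕ) → TkResidualW F N (FluctV N) K)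

/-- **THE TWO-LETTER STAGE-13 WITNESS FAMILY** `θ₁₃(ε₀, ε₂₉) := θ₀ᶠᵃᵐ,¹³(ε₀, ε₂₉).liveRepin₁₃` — the term the (D4) ∕ N26 ∕ N1-small ₁₃ consumers instantiate at, with
their `ε₂₉`-smallness and `δ + 4·ε₂₉ ≤ ε₀` DISPLAYED. [cite: Balaban1989LargeFieldI, (0.3) p.176 and p.177; Balaban1987RG1, (1.2) p.260, (2.9) p.266 (bookkeeping witness)] -/
def theta13LiveOfFamily₂ : Stage13Params F N :=
  (theta13OfFamily₂ F N ε₀ ε₂₉ ζ Rz Zt).liveRepin₁₃ F N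

/-- Unfolding (`rfl`). [cite: Balaban1989LargeFieldI, (0.3) p.176 (bookkeeping)] -/
theorem theta13LiveOfFamily₂_eq : theta13LiveOfFamily₂ F N ε₀ ε₂₉ ζ Rz Zt = (theta13OfFamily₂ F N ε₀ ε₂₉ ζ Rz Zt).liveRepin₁₃ F N := rfl

/-- `θ₁₃(ε₀, ε₂₉).ε₂₉ = ε₂₉` (`rfl`). [cite: Balaban1987RG1, (2.9) p.266 (bookkeeping)] -/
theorem theta13LiveOfFamily₂_ε₂₉ : (theta13LiveOfFamily₂ F N ε₀ ε₂₉ ζ Rz Zt).ε₂₉ = ε₂₉ := rfl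

/-- `θ₁₃(ε₀, ε₂₉).ν.ε₀ = ε₀` (`rfl`). [cite: Balaban1987RG1, (1.2) p.260 (bookkeeping)] -/
theorem theta13LiveOfFamily₂_ε₀ : (theta13LiveOfFamily₂ F N ε₀ ε₂₉ ζ Rz Zt).ν.ε₀ = ε₀ := rfl

/-- `θ₁₃(ε₀, ε₂₉).ν = numerics7OfFamily ε₀` (`rfl`). [cite: Balaban1988Convergent, (2.4) p.255 (bookkeeping)] -/
theorem theta13LiveOfFamily₂_ν : (theta13LiveOfFamily₂ F N ε₀ ε₂₉ ζ Rz Zt).ν = numerics7OfFamily ε₀ := rfl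

/-- `θ₁₃(ε₀, ε₂₉).γ = 1∕2` (`rfl`). [cite: Balaban1987RG1, Thm 1 p.255 (bookkeeping)] -/
theorem theta13LiveOfFamily₂_γ : (theta13LiveOfFamily₂ F N ε₀ ε₂₉ ζ Rz Zt).γ = 1 / 2 := rfl

/-- `θ₁₃(ε₀, ε₂₉).A₁ = 1` (`rfl`). [cite: Balaban1987RG1, (1.16) p.262 (bookkeeping)] -/
theorem theta13LiveOfFamily₂_A₁ : (theta13LiveOfFamily₂ F N ε₀ ε₂₉ ζ Rz Zt).A₁ = 1 := rfl

/-- `θ₁₃(ε₀, ε₂₉).s2.lf.κ = 2·10⁴` (`rfl`). [cite: Balaban1987RG1, (1.18) p.263 (bookkeeping)] -/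
theorem theta13LiveOfFamily₂_κ : (theta13LiveOfFamily₂ F N ε₀ ε₂₉ ζ Rz Zt).s2.lf.κ = 20000 := rfl

/-- `θ₁₃(ε₀, ε₂₉).ℓ₆ + 1 = F.L`. [cite: Balaban1987RG1, (0.1) p.251 (bookkeeping)] -/
theorem theta13LiveOfFamily₂_ℓ₆_succ : (theta13LiveOfFamily₂ F N ε₀ ε₂₉ ζ Rz Zt).ℓ₆ + 1 = F.L := stage3OfFamily_ℓ₆_succ F

/-- **N10's Lemma-3 level-T binder at the family**: `8 ≤ θ.ℓ₆ + 1`. [cite: Balaban1987RG1, (0.1) p.251; Balaban1988RG2Cluster, (2.36) p.19] -/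
theorem eight_le_L_theta13LiveOfFamily₂ : 8 ≤ (theta13LiveOfFamily₂ F N ε₀ ε₂₉ ζ Rz Zt).ℓ₆ + 1 := eight_le_L_stage3OfFamily F

/-- `θ₁₃(ε₀, ε₂₉)`'s selector IS the live selector of record along the ₁₃ plugs of the family (`rfl`). [cite: Balaban1989LargeFieldI, (0.3) p.176 (bookkeeping)] -/
theorem theta13LiveOfFamily₂_ppSel :
    (theta13LiveOfFamily₂ F N ε₀ ε₂₉ ζ Rz Zt).ppSel =
      ppSelLiveOfRecord F N (numerics7OfFamily ε₀) towerNumericsOfRecord₁₂ (EOfRecord₁₃ F N (theta13OfFamily₂ F N ε₀ ε₂₉ ζ Rz Zt))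
        (wOfRecord₉ F N (theta12OfFamilyL F N ε₀ ζ Rz Zt).toStage9Params) := rfl

variable {ε₀ ε₂₉} in
/-- **`θ₁₃(ε₀, ε₂₉)` IS STAGE-13 ADMISSIBLE under `0 < ε₀`, `0 < ε₂₉`** (row G at the family). [cite: Balaban1987RG1, (0.21) p.256, (1.2) p.260, (2.9) p.266; Balaban1988Convergent, (2.10) p.256 (bookkeeping witness)] -/
theorem admissible_theta13LiveOfFamily₂ (hε : 0 < ε₀) (hε' : 0 < ε₂₉) : (theta13LiveOfFamily₂ F N ε₀ ε₂₉ ζ Rz Zt).Admissible F N :=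
  (admissible_theta13OfFamily₂ F N ζ Rz Zt hε hε').liveRepin₁₃

/-- Row N1 at the family: the (D4) `tree` numeral. [cite: Balaban1987RG1, (0.25)–(0.26) p.257] -/
theorem kp_tree_theta13LiveOfFamily₂ : 128 * Real.log 162 ≤ (theta13LiveOfFamily₂ F N ε₀ ε₂₉ ζ Rz Zt).s2.lf.κ := kp_tree_lfConstsOfFamily

/-- Row N1 at the family: the (D4) `large` numeral at the family's block size. [cite: Balaban1987RG1, (0.25)–(0.26) p.257; Balaban1988RG2Cluster, p.21 (after (2.39))] -/
theorem kp_large_theta13LiveOfFamily₂ :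
    10 * (64 * Real.log 162 + 1) ≤
      (((((theta13LiveOfFamily₂ F N ε₀ ε₂₉ ζ Rz Zt).ℓ₆ + 1 : ℕ) : ℝ)) / 2 - 1) * (theta13LiveOfFamily₂ F N ε₀ ε₂₉ ζ Rz Zt).s2.lf.κ :=
  kp_large_theta12OfFamilyL F N ε₀ ζ Rz Zt

/-- Row N1 at the family: N10's rate threshold. [cite: Balaban1987RG1, (1.18) p.263 (bookkeeping numeral)] -/
theorem kp_n10_theta13LiveOfFamily₂ : (2 * 10 ^ 4 : ℝ) ≤ (theta13LiveOfFamily₂ F N ε₀ ε₂₉ ζ Rz Zt).s2.lf.κ := kp_n10_lfConstsOfFamily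

/-- **At K0b's residuals of record the family carries them** (`⟨rfl, rfl, rfl⟩`). [cite: Balaban1988Convergent, (3.16) p.268, (2.21) p.258, (3.20) p.269 (bookkeeping)] -/
theorem hasResidualsOfRecord_theta13LiveOfFamily₂ :
    (theta13LiveOfFamily₂ F N ε₀ ε₂₉ (zeta316OfRecord F N (numerics7OfFamily ε₀) 1 1) (RzOfRecord F N) (ZtOfRecord F N)).HasResidualsOfRecord F N :=
  ⟨rfl, rfl, rfl⟩

/-- **… hence `ZtUnity` at every member** (row Z). [cite: Balaban1988Convergent, (3.16)–(3.20) pp.268–269] -/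
theorem ztUnity_theta13LiveOfFamily₂ :
    (theta13LiveOfFamily₂ F N ε₀ ε₂₉ (zeta316OfRecord F N (numerics7OfFamily ε₀) 1 1) (RzOfRecord F N) (ZtOfRecord F N)).ZtUnity F N :=
  (hasResidualsOfRecord_theta13LiveOfFamily₂ F N ε₀ ε₂₉).ztUnity

/-- **★ ROW P12 at every member from `Provisos₁₃` there alone.** [cite: Balaban1988Convergent, (3.22) p.269, (3.24) p.270; Balaban1989LargeFieldI, (0.3)–(0.4) p.176] -/
theorem slotsNondegenerate₁₃_theta13LiveOfFamily₂ (h : (theta13LiveOfFamily₂ F N ε₀ ε₂₉ ζ Rz Zt).Provisos₁₃ F N) :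
    (theta13LiveOfFamily₂ F N ε₀ ε₂₉ ζ Rz Zt).SlotsNondegenerate₁₃ F N :=
  Stage13Params.slotsNondegenerate₁₃_liveRepin F N (theta13OfFamily₂ F N ε₀ ε₂₉ ζ Rz Zt) h

/-- **★ `Provisos₁₃` at every member carrying K0b's residuals FROM ROW P11 ALONE** (FILE 8's `provisos₁₃_liveRepin₁₃_of_bg`; (H-U) by K0c's `localBgMeasurable`).
[cite: Balaban1988Convergent, (2.18) p.257, (2.28) p.259, (3.16) p.268, (3.22) p.269; Balaban1989LargeFieldI, (0.3)–(0.4) p.176 (bookkeeping)] -/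
theorem provisos₁₃_theta13LiveOfFamily₂_of_bg
    (hbg : ∀ (p : B12.RunParams) (n : ℕ), n ≤ p.K →
      Step.InInterval (theta13OfFamily₂ F N ε₀ ε₂₉ (zeta316OfRecord F N (numerics7OfFamily ε₀) 1 1) (RzOfRecord F N) (ZtOfRecord F N)).γ n
        (gOfRecord₁₃ F N (theta13OfFamily₂ F N ε₀ ε₂₉ (zeta316OfRecord F N (numerics7OfFamily ε₀) 1 1) (RzOfRecord F N) (ZtOfRecord F N)) p) →
      BgProvisoΛ F N p.K
        (settingOfRecord₁₃ F N (theta13LiveOfFamily₂ F N ε₀ ε₂₉ (zeta316OfRecord F N (numerics7OfFamily ε₀) 1 1) (RzOfRecord F N) (ZtOfRecord F N)) p)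
        (RzOfRecord F N p.K) 1 n
        (suppOfRecord₁₃ F N (theta13LiveOfFamily₂ F N ε₀ ε₂₉ (zeta316OfRecord F N (numerics7OfFamily ε₀) 1 1) (RzOfRecord F N) (ZtOfRecord F N)) p n)
        (UbgOfRecord₁₃ F N (theta13LiveOfFamily₂ F N ε₀ ε₂₉ (zeta316OfRecord F N (numerics7OfFamily ε₀) 1 1) (RzOfRecord F N) (ZtOfRecord F N)) p n)) :
    (theta13LiveOfFamily₂ F N ε₀ ε₂₉ (zeta316OfRecord F N (numerics7OfFamily ε₀) 1 1) (RzOfRecord F N) (ZtOfRecord F N)).Provisos₁₃ F N :=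
  (theta13OfFamily₂ F N ε₀ ε₂₉ _ _ _).provisos₁₃_liveRepin₁₃_of_bg (hasResidualsOfRecord_theta13OfFamily₂ F N ε₀ ε₂₉) hbg

/-- **★★ THE K0″ BODY FOR `F` AT `N = 2` FROM ANY MEMBER under `0 < ε₀`, `0 < ε₂₉` and `Provisos₁₃` there.** [cite: Balaban1988Convergent, Thm 1 p.262, (3.16)–(3.22) pp.268–269; Balaban1989LargeFieldI, (0.3)–(0.4) p.176 (bookkeeping)] -/
theorem exists_k0_of_theta13LiveOfFamily₂_of_provisos₁₃ (F : T4Family) {ε₀ ε₂₉ : ℝ} (hε : 0 < ε₀) (hε' : 0 < ε₂₉)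
    (h : (theta13LiveOfFamily₂ F 2 ε₀ ε₂₉ (zeta316OfRecord F 2 (numerics7OfFamily ε₀) 1 1) (RzOfRecord F 2) (ZtOfRecord F 2)).Provisos₁₃ F 2) :
    ∃ θ : Stage13Params F 2, θ.Provisos₁₃ F 2 ∧ (θ.ZtUnity F 2 ∧ θ.SlotsNondegenerate₁₃ F 2) ∧ θ.Admissible F 2 :=
  ⟨_, h, ⟨ztUnity_theta13LiveOfFamily₂ F 2 ε₀ ε₂₉, slotsNondegenerate₁₃_theta13LiveOfFamily₂ F 2 ε₀ ε₂₉ _ _ _ h⟩,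
    admissible_theta13LiveOfFamily₂ F 2 _ _ _ hε hε'⟩

/-- **★★★ THE K0″ BODY FOR `F` AT `N = 2` FROM ANY MEMBER under `0 < ε₀`, `0 < ε₂₉` and ROW P11 there ALONE** — the form a consumer carrying displayed
`ε₂₉`-smallness ∕ `δ + 4·ε₂₉ ≤ ε₀` instantiates without pinning a numeral. [cite: Balaban1988Convergent, Thm 1 p.262, (2.7) p.255, (2.28) p.259, (3.16)–(3.22) pp.268–269; Balaban1989LargeFieldI, (0.3)–(0.4) p.176 (bookkeeping)] -/
theorem exists_k0_of_bg_theta13LiveOfFamily₂ (F : T4Family) {ε₀ ε₂₉ : ℝ} (hε : 0 < ε₀) (hε' : 0 < ε₂₉)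
    (hbg : ∀ (p : B12.RunParams) (n : ℕ), n ≤ p.K →
      Step.InInterval (theta13OfFamily₂ F 2 ε₀ ε₂₉ (zeta316OfRecord F 2 (numerics7OfFamily ε₀) 1 1) (RzOfRecord F 2) (ZtOfRecord F 2)).γ n
        (gOfRecord₁₃ F 2 (theta13OfFamily₂ F 2 ε₀ ε₂₉ (zeta316OfRecord F 2 (numerics7OfFamily ε₀) 1 1) (RzOfRecord F 2) (ZtOfRecord F 2)) p) →
      BgProvisoΛ F 2 p.K
        (settingOfRecord₁₃ F 2 (theta13LiveOfFamily₂ F 2 ε₀ ε₂₉ (zeta316OfRecord F 2 (numerics7OfFamily ε₀) 1 1) (RzOfRecord F 2) (ZtOfRecord F 2)) p)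
        (RzOfRecord F 2 p.K) 1 n
        (suppOfRecord₁₃ F 2 (theta13LiveOfFamily₂ F 2 ε₀ ε₂₉ (zeta316OfRecord F 2 (numerics7OfFamily ε₀) 1 1) (RzOfRecord F 2) (ZtOfRecord F 2)) p n)
        (UbgOfRecord₁₃ F 2 (theta13LiveOfFamily₂ F 2 ε₀ ε₂₉ (zeta316OfRecord F 2 (numerics7OfFamily ε₀) 1 1) (RzOfRecord F 2) (ZtOfRecord F 2)) p n)) :
    ∃ θ : Stage13Params F 2, θ.Provisos₁₃ F 2 ∧ (θ.ZtUnity F 2 ∧ θ.SlotsNondegenerate₁₃ F 2) ∧ θ.Admissible F 2 :=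
  exists_k0_of_theta13LiveOfFamily₂_of_provisos₁₃ F hε hε' (provisos₁₃_theta13LiveOfFamily₂_of_bg F 2 ε₀ ε₂₉ hbg)

/-- **FILE 8's one-letter live family IS the member `ε₂₉ := ε₀ ∕ 8`** (`rfl`). [cite: Balaban1987RG1, (2.9) p.266 (bookkeeping)] -/
theorem theta13LiveOfFamily_eq_family₂ : theta13LiveOfFamily F N ε₀ ζ Rz Zt = theta13LiveOfFamily₂ F N ε₀ (eps29OfFamily ε₀) ζ Rz Zt := rfl

/-- **THE WITNESS OF RECORD IS THE MEMBER `(ε₀, ε₂₉) = (eps0OfRecord₁₃, eps29OfFamily eps0OfRecord₁₃) = (1, ⅛)`** (`rfl`) — so every face of this file at the member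
transfers to `theta13LiveOfRecord` by rewriting, and every numeral-free consumer statement AT THE FAMILY specialises to the record. [cite: Balaban1987RG1, (1.2) p.260, (2.9) p.266 (bookkeeping)] -/
theorem theta13LiveOfRecord_eq_family₂ :
    theta13LiveOfRecord F N =
      theta13LiveOfFamily₂ F N eps0OfRecord₁₃ (eps29OfFamily eps0OfRecord₁₃) (zeta316OfRecord F N (numerics7OfFamily eps0OfRecord₁₃) 1 1)
        (RzOfRecord F N) (ZtOfRecord F N) := rfl

end LiveFamily2

/-! ## §3. THE ALL-NUMERICS FAMILY `θ₁₃(n, ε₂₉) = theta13LiveOfNumerics F N n ε₂₉ ζ Rz Zt` — EVERY numeric letter an argument (`n : Stage12Numerics`), the dictionary the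
family's; the socket for numerics keyed to print's undetermined constants (def-P11 LOCATED-P11-NUMERICS: row P11 from [15] Thm 1 needs `C₀`, `q₀`, `εreg`, `γ` tied to
[15]'s `B₃, a₀, a₁` — a later `n` carries them; K1′'s `Nmem`∕`γ` likewise) -/

section AllNumerics

variable (F : T4Family) (N : ℕ) [NeZero N] (n : Stage12Numerics) (ε₂₉ : ℝ)
variable (ζ : ZetaOfRecord F N n.ν n.τ9.M) (Rz : (K : ℕ) → Sect2.Residual (F.P K) (MatA N)) (Zt : (K : ℕ) → TkResidualW F N (FluctV N) K)

/-- **THE STAGE-13 PARAMETER AT ARBITRARY NUMERICS `n`** (identity selector): the D-maker at the dictionary OF THE FAMILY and `n`, extended by `ε₂₉`.  Every numerics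
re-pin of the K0′ witness (rows N1∕N2, [15]'s constants for P11, K1′'s tower numerics) is an INSTANCE — no further K0a definition is needed.
[cite: Balaban1987RG1, (0.1) p.251, (0.21) p.256, (1.2) p.260, (2.9) p.266; Balaban1988Convergent, (2.4) p.255, (2.10) p.256, (2.28) p.259 (parameter dictionary; bookkeeping witness)] -/
def theta13OfNumerics : Stage13Params F N :=
  { stage12OfNumericsD F N (stage3OfFamily F) n (residual5OfRecord₁₂ F N) ζ Rz Zt with ε₂₉ := ε₂₉ }

/-- The all-numerics parameter's Stage-12 part IS the D-maker's term (`rfl`). [cite: Balaban1988Convergent, (2.10) p.256 (bookkeeping)] -/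
theorem theta13OfNumerics_toStage12Params :
    (theta13OfNumerics F N n ε₂₉ ζ Rz Zt).toStage12Params = stage12OfNumericsD F N (stage3OfFamily F) n (residual5OfRecord₁₂ F N) ζ Rz Zt := rfl

/-- Its (2.9) letter IS the argument (`rfl`). [cite: Balaban1987RG1, (2.9) p.266 (bookkeeping)] -/
theorem theta13OfNumerics_ε₂₉ : (theta13OfNumerics F N n ε₂₉ ζ Rz Zt).ε₂₉ = ε₂₉ := rfl

/-- Its numerics ARE `n`'s: Stage-7 part (`rfl`). [cite: Balaban1988Convergent, (2.4) p.255 (bookkeeping)] -/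
theorem theta13OfNumerics_ν : (theta13OfNumerics F N n ε₂₉ ζ Rz Zt).ν = n.ν := rfl

/-- … §2 numerics (`rfl`). [cite: Balaban1988Convergent, (2.28) p.259 (bookkeeping)] -/
theorem theta13OfNumerics_s2 : (theta13OfNumerics F N n ε₂₉ ζ Rz Zt).s2 = n.s2 := rfl

/-- … window constant (`rfl`). [cite: Balaban1987RG1, Thm 1 p.255 (bookkeeping)] -/
theorem theta13OfNumerics_γ : (theta13OfNumerics F N n ε₂₉ ζ Rz Zt).γ = n.γ := rfl

/-- … and its block size is the family's: `ℓ₆ + 1 = F.L`. [cite: Balaban1987RG1, (0.1) p.251 (bookkeeping)] -/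
theorem theta13OfNumerics_ℓ₆_succ : (theta13OfNumerics F N n ε₂₉ ζ Rz Zt).ℓ₆ + 1 = F.L := stage3OfFamily_ℓ₆_succ F

variable {n ε₂₉} in
/-- **Stage-13 admissible ⟸ `n.Pos` ∧ `0 < ε₂₉`** (the dictionary of the family is admissible). [cite: Balaban1987RG1, (0.21) p.256, (2.9) p.266; Balaban1988Convergent, (2.10) p.256 (bookkeeping)] -/
theorem admissible_theta13OfNumerics (hn : n.Pos) (hε' : 0 < ε₂₉) : (theta13OfNumerics F N n ε₂₉ ζ Rz Zt).Admissible F N :=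
  ⟨admissible_stage12OfNumericsD F N (stage3OfFamily F) n (residual5OfRecord₁₂ F N) ζ Rz Zt (admissible_stage3OfFamily F) hn, hε'⟩

/-- It carries K0b's residuals of record at `ζ := zeta316OfRecord F N n.ν n.τ9.M n.A₁` (`⟨rfl, rfl, rfl⟩`). [cite: Balaban1988Convergent, (3.16) p.268, (2.21) p.258, (3.20) p.269 (bookkeeping)] -/
theorem hasResidualsOfRecord_theta13OfNumerics :
    (theta13OfNumerics F N n ε₂₉ (zeta316OfRecord F N n.ν n.τ9.M n.A₁) (RzOfRecord F N) (ZtOfRecord F N)).HasResidualsOfRecord F N :=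
  ⟨rfl, rfl, rfl⟩

/-- **THE ALL-NUMERICS WITNESS FAMILY** `θ₁₃(n, ε₂₉) := θ(n, ε₂₉).liveRepin₁₃`. [cite: Balaban1989LargeFieldI, (0.3) p.176 and p.177 (bookkeeping witness)] -/
def theta13LiveOfNumerics : Stage13Params F N :=
  (theta13OfNumerics F N n ε₂₉ ζ Rz Zt).liveRepin₁₃ F N

/-- Unfolding (`rfl`). [cite: Balaban1989LargeFieldI, (0.3) p.176 (bookkeeping)] -/
theorem theta13LiveOfNumerics_eq : theta13LiveOfNumerics F N n ε₂₉ ζ Rz Zt = (theta13OfNumerics F N n ε₂₉ ζ Rz Zt).liveRepin₁₃ F N := rfl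

/-- N10's Lemma-3 level-T binder at every member: `8 ≤ θ.ℓ₆ + 1`. [cite: Balaban1987RG1, (0.1) p.251; Balaban1988RG2Cluster, (2.36) p.19] -/
theorem eight_le_L_theta13LiveOfNumerics : 8 ≤ (theta13LiveOfNumerics F N n ε₂₉ ζ Rz Zt).ℓ₆ + 1 := eight_le_L_stage3OfFamily F

variable {n ε₂₉} in
/-- **Admissible ⟸ `n.Pos` ∧ `0 < ε₂₉`** (row G at every member). [cite: Balaban1987RG1, (0.21) p.256, (2.9) p.266; Balaban1988Convergent, (2.10) p.256 (bookkeeping)] -/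
theorem admissible_theta13LiveOfNumerics (hn : n.Pos) (hε' : 0 < ε₂₉) : (theta13LiveOfNumerics F N n ε₂₉ ζ Rz Zt).Admissible F N :=
  (admissible_theta13OfNumerics F N ζ Rz Zt hn hε').liveRepin₁₃

/-- At K0b's residuals every member carries them (`⟨rfl, rfl, rfl⟩`). [cite: Balaban1988Convergent, (3.16) p.268, (2.21) p.258, (3.20) p.269 (bookkeeping)] -/
theorem hasResidualsOfRecord_theta13LiveOfNumerics :
    (theta13LiveOfNumerics F N n ε₂₉ (zeta316OfRecord F N n.ν n.τ9.M n.A₁) (RzOfRecord F N) (ZtOfRecord F N)).HasResidualsOfRecord F N :=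
  ⟨rfl, rfl, rfl⟩

/-- **… hence `ZtUnity`** (row Z at every member). [cite: Balaban1988Convergent, (3.16)–(3.20) pp.268–269] -/
theorem ztUnity_theta13LiveOfNumerics :
    (theta13LiveOfNumerics F N n ε₂₉ (zeta316OfRecord F N n.ν n.τ9.M n.A₁) (RzOfRecord F N) (ZtOfRecord F N)).ZtUnity F N :=
  (hasResidualsOfRecord_theta13LiveOfNumerics F N n ε₂₉).ztUnity

/-- **★ Row P12 at every member from `Provisos₁₃` there alone.** [cite: Balaban1988Convergent, (3.22) p.269, (3.24) p.270; Balaban1989LargeFieldI, (0.3)–(0.4) p.176] -/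
theorem slotsNondegenerate₁₃_theta13LiveOfNumerics (h : (theta13LiveOfNumerics F N n ε₂₉ ζ Rz Zt).Provisos₁₃ F N) :
    (theta13LiveOfNumerics F N n ε₂₉ ζ Rz Zt).SlotsNondegenerate₁₃ F N :=
  Stage13Params.slotsNondegenerate₁₃_liveRepin F N (theta13OfNumerics F N n ε₂₉ ζ Rz Zt) h

/-- **★ `Provisos₁₃` at every member carrying K0b's residuals FROM ROW P11 ALONE.** [cite: Balaban1988Convergent, (2.18) p.257, (2.28) p.259, (3.16) p.268, (3.22) p.269; Balaban1989LargeFieldI, (0.3)–(0.4) p.176 (bookkeeping)] -/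
theorem provisos₁₃_theta13LiveOfNumerics_of_bg
    (hbg : ∀ (p : B12.RunParams) (m : ℕ), m ≤ p.K →
      Step.InInterval (theta13OfNumerics F N n ε₂₉ (zeta316OfRecord F N n.ν n.τ9.M n.A₁) (RzOfRecord F N) (ZtOfRecord F N)).γ m
        (gOfRecord₁₃ F N (theta13OfNumerics F N n ε₂₉ (zeta316OfRecord F N n.ν n.τ9.M n.A₁) (RzOfRecord F N) (ZtOfRecord F N)) p) →
      BgProvisoΛ F N p.K
        (settingOfRecord₁₃ F N (theta13LiveOfNumerics F N n ε₂₉ (zeta316OfRecord F N n.ν n.τ9.M n.A₁) (RzOfRecord F N) (ZtOfRecord F N)) p)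
        (RzOfRecord F N p.K) n.τ9.M m
        (suppOfRecord₁₃ F N (theta13LiveOfNumerics F N n ε₂₉ (zeta316OfRecord F N n.ν n.τ9.M n.A₁) (RzOfRecord F N) (ZtOfRecord F N)) p m)
        (UbgOfRecord₁₃ F N (theta13LiveOfNumerics F N n ε₂₉ (zeta316OfRecord F N n.ν n.τ9.M n.A₁) (RzOfRecord F N) (ZtOfRecord F N)) p m)) :
    (theta13LiveOfNumerics F N n ε₂₉ (zeta316OfRecord F N n.ν n.τ9.M n.A₁) (RzOfRecord F N) (ZtOfRecord F N)).Provisos₁₃ F N :=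
  (theta13OfNumerics F N n ε₂₉ _ _ _).provisos₁₃_liveRepin₁₃_of_bg (hasResidualsOfRecord_theta13OfNumerics F N n ε₂₉) hbg

/-- **★★★ THE K0″ BODY FOR `F` AT `N = 2` AT ANY NUMERICS from `n.Pos`, `0 < ε₂₉` and ROW P11 there ALONE** — the socket a numerics-carrying P11 supplier
(«∀ B₃ a₀ a₁, [15]-fact → bg at θ(n(B₃, a₀, a₁))», def-P11) plugs into with no further K0a definition. [cite: Balaban1988Convergent, Thm 1 p.262, (2.7) p.255, (2.28) p.259, (3.16)–(3.22) pp.268–269; Balaban1989LargeFieldI, (0.3)–(0.4) p.176 (bookkeeping)] -/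
theorem exists_k0_of_bg_theta13LiveOfNumerics (F : T4Family) {n : Stage12Numerics} {ε₂₉ : ℝ} (hn : n.Pos) (hε' : 0 < ε₂₉)
    (hbg : ∀ (p : B12.RunParams) (m : ℕ), m ≤ p.K →
      Step.InInterval (theta13OfNumerics F 2 n ε₂₉ (zeta316OfRecord F 2 n.ν n.τ9.M n.A₁) (RzOfRecord F 2) (ZtOfRecord F 2)).γ m
        (gOfRecord₁₃ F 2 (theta13OfNumerics F 2 n ε₂₉ (zeta316OfRecord F 2 n.ν n.τ9.M n.A₁) (RzOfRecord F 2) (ZtOfRecord F 2)) p) →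
      BgProvisoΛ F 2 p.K
        (settingOfRecord₁₃ F 2 (theta13LiveOfNumerics F 2 n ε₂₉ (zeta316OfRecord F 2 n.ν n.τ9.M n.A₁) (RzOfRecord F 2) (ZtOfRecord F 2)) p)
        (RzOfRecord F 2 p.K) n.τ9.M m
        (suppOfRecord₁₃ F 2 (theta13LiveOfNumerics F 2 n ε₂₉ (zeta316OfRecord F 2 n.ν n.τ9.M n.A₁) (RzOfRecord F 2) (ZtOfRecord F 2)) p m)
        (UbgOfRecord₁₃ F 2 (theta13LiveOfNumerics F 2 n ε₂₉ (zeta316OfRecord F 2 n.ν n.τ9.M n.A₁) (RzOfRecord F 2) (ZtOfRecord F 2)) p m)) :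
    ∃ θ : Stage13Params F 2, θ.Provisos₁₃ F 2 ∧ (θ.ZtUnity F 2 ∧ θ.SlotsNondegenerate₁₃ F 2) ∧ θ.Admissible F 2 :=
  ⟨_, provisos₁₃_theta13LiveOfNumerics_of_bg F 2 n ε₂₉ hbg,
    ⟨ztUnity_theta13LiveOfNumerics F 2 n ε₂₉,
      slotsNondegenerate₁₃_theta13LiveOfNumerics F 2 n ε₂₉ _ _ _ (provisos₁₃_theta13LiveOfNumerics_of_bg F 2 n ε₂₉ hbg)⟩,
    admissible_theta13LiveOfNumerics F 2 _ _ _ hn hε'⟩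

/-- **The two-letter family IS the member `n := stage12NumericsOfFamily ε₀`** (`rfl`) — and so are FILE 8's one-letter family and the witness of record.
[cite: Balaban1988Convergent, (2.10) p.256 (bookkeeping)] -/
theorem theta13LiveOfFamily₂_eq_numerics (ε₀ ε₂₉' : ℝ) (ζ' : ZetaOfRecord F N (numerics7OfFamily ε₀) 1) :
    theta13LiveOfFamily₂ F N ε₀ ε₂₉' ζ' Rz Zt = theta13LiveOfNumerics F N (stage12NumericsOfFamily ε₀) ε₂₉' ζ' Rz Zt := rfl

end AllNumerics

/-! ## §4. (v1.1) ROW P12 AT THE ₁₃ LIVE RE-PIN FROM (H-U) AND K0b's RESIDUAL LAWS ALONE — no proviso field is read -/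

section RowP12Free

variable {F : T4Family} {N : ℕ} [NeZero N] {θ : Stage13Params F N}

/-- **★ ROW P12 (`SlotsNondegenerate₁₃`) AT THE ₁₃ LIVE RE-PIN OF A PARAMETER CARRYING K0b's RESIDUALS FROM (H-U) ALONE** — FILE 8's Int instance
`slotsNondegenerate₁₃_liveRepin_of_int (hT) (hR)` with BOTH inputs supplied by `Record13` §4c's theorems of the measurability hypothesis (H-U) `LocalBgMeasurable θ.ν`
and the ζ-laws of K0b's (3.16) factor: the step provisos `hT` field by field (`intPiece₁₃_of_localBg` at the live selector, `measω₁₃_∕measChi₁₃_of_localBg`,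
`abs_wOfRecord_le_one`, `isStepUnity_wOfRecord`) and the Int-form R-step provisos `hR` by `rstep₁₃_of_localBg_liveSel` (`hsel` is `rfl` at the re-pin).  NO field of
`Provisos₁₃` is read — in particular not `bg`.  A REDUCTION — nothing of Bałaban asserted.
[cite: Balaban1988Convergent, (2.18) p.257, (3.2)–(3.9) pp.265–266, (3.16) p.268, (3.22) p.269, (3.24)–(3.25) p.270; Balaban1989LargeFieldI, (0.3)–(0.4) p.176 and p.177 (bookkeeping)] -/
theorem Stage13Params.slotsNondegenerate₁₃_liveRepin_of_localBg (hU : LocalBgMeasurable F N θ.ν) (hres : θ.HasResidualsOfRecord F N) :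
    (θ.liveRepin₁₃ F N).SlotsNondegenerate₁₃ F N :=
  have hζ : ZetaMeasurable F N θ.ζ := by
    rw [hres.zeta_eq]; exact zetaMeasurable_zeta316OfRecord_of_localBg hU θ.τ9.M θ.A₁
  have hζ0 : ∀ p g k s Pl Ql RS U V', 0 ≤ θ.ζ p g k s Pl Ql RS U V' := by
    rw [hres.zeta_eq]; exact fun p g k s Pl Ql RS U V' => zeta316OfRecord_nonneg θ.A₁ p g k s Pl Ql RS U V'
  Stage13Params.slotsNondegenerate₁₃_liveRepin_of_int F N θ
    (fun p k hk =>
      { intPiece := (θ.liveRepin₁₃ F N).intPiece₁₃_of_localBg hU hζ hres.zetaAbs hζ0 p k hk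
        measW := fun s' => measurable_wOfRecord F N θ.ν θ.τ9.M θ.A₁ θ.ζ p (gOfRecord₁₃ F N θ p) k (θ.measω₁₃_of_localBg hU hζ p k hk) s'
        absW_le := fun s' U V' => abs_wOfRecord_le_one F N θ.ν θ.τ9.M θ.A₁ hres.zetaAbs p (gOfRecord₁₃ F N θ p) k s' U V'
        measChi := θ.measChi₁₃_of_localBg hU p k hk
        unity := isStepUnity_wOfRecord F N θ.ν θ.τ9.M θ.A₁ hres.zetaUnity p (gOfRecord₁₃ F N θ p) k })
    (fun p j _ hj => (θ.liveRepin₁₃ F N).rstep₁₃_of_localBg_liveSel rfl hU hζ hres.zetaAbs hζ0 p j hj)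

/-- **★★ ROW P12 AT THE ₁₃ LIVE RE-PIN OF A PARAMETER CARRYING K0b's RESIDUALS — OUTRIGHT** ((H-U) is seat K0c's theorem `localBgMeasurable`,
`Node00/Record12MeasurabilityAbsolute`).  No proviso is read. [cite: Balaban1988Convergent, (3.22) p.269, (3.24)–(3.25) p.270; Balaban1989LargeFieldI, (0.3)–(0.4) p.176 (bookkeeping)] -/
theorem Stage13Params.slotsNondegenerate₁₃_liveRepin_of_hasResiduals (hres : θ.HasResidualsOfRecord F N) :
    (θ.liveRepin₁₃ F N).SlotsNondegenerate₁₃ F N :=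
  Stage13Params.slotsNondegenerate₁₃_liveRepin_of_localBg (localBgMeasurable F N θ.ν) hres

end RowP12Free

section RowP12FreeFamilies

variable (F : T4Family) (N : ℕ) [NeZero N]

/-- **ROW P12 AT EVERY MEMBER OF THE ALL-NUMERICS FAMILY AT K0b's RESIDUALS — HYPOTHESIS-FREE** (no `n.Pos`, no proviso). [cite: Balaban1988Convergent, (3.22) p.269; Balaban1989LargeFieldI, (0.3)–(0.4) p.176 (bookkeeping)] -/
theorem slotsNondegenerate₁₃_theta13LiveOfNumerics_of_hasResiduals (n : Stage12Numerics) (ε₂₉ : ℝ) :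
    (theta13LiveOfNumerics F N n ε₂₉ (zeta316OfRecord F N n.ν n.τ9.M n.A₁) (RzOfRecord F N) (ZtOfRecord F N)).SlotsNondegenerate₁₃ F N :=
  Stage13Params.slotsNondegenerate₁₃_liveRepin_of_hasResiduals (θ := theta13OfNumerics F N n ε₂₉ _ _ _)
    (hasResidualsOfRecord_theta13OfNumerics F N n ε₂₉)

/-- **ROW P12 AT EVERY MEMBER OF THE TWO-LETTER FAMILY AT K0b's RESIDUALS — HYPOTHESIS-FREE.** [cite: Balaban1988Convergent, (3.22) p.269; Balaban1989LargeFieldI, (0.3)–(0.4) p.176 (bookkeeping)] -/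
theorem slotsNondegenerate₁₃_theta13LiveOfFamily₂_of_hasResiduals (ε₀ ε₂₉ : ℝ) :
    (theta13LiveOfFamily₂ F N ε₀ ε₂₉ (zeta316OfRecord F N (numerics7OfFamily ε₀) 1 1) (RzOfRecord F N) (ZtOfRecord F N)).SlotsNondegenerate₁₃ F N :=
  Stage13Params.slotsNondegenerate₁₃_liveRepin_of_hasResiduals (θ := theta13OfFamily₂ F N ε₀ ε₂₉ _ _ _)
    (hasResidualsOfRecord_theta13OfFamily₂ F N ε₀ ε₂₉)

/-- **ROW P12 AT THE WITNESS OF RECORD — HYPOTHESIS-FREE** (FILE 8's `slotsNondegenerate₁₃_theta13LiveOfRecord (h : Provisos₁₃)` without its hypothesis).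
[cite: Balaban1988Convergent, (3.22) p.269; Balaban1989LargeFieldI, (0.3)–(0.4) p.176 (bookkeeping)] -/
theorem slotsNondegenerate₁₃_theta13LiveOfRecord_of_hasResiduals : (theta13LiveOfRecord F N).SlotsNondegenerate₁₃ F N :=
  Stage13Params.slotsNondegenerate₁₃_liveRepin_of_hasResiduals (θ := theta13OfFamily F N eps0OfRecord₁₃ _ _ _)
    (hasResidualsOfRecord_theta13OfFamily F N eps0OfRecord₁₃)

end RowP12FreeFamilies

end Literature.MathematicalPhysics.QuantumFieldTheory.Balaban1983to89.Node00

end
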